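import Literature.NumberTheory.DiophantineGeometry.GenEllProjLine
import Literature.NumberTheory.DiophantineGeometry.GenEllBDClasses
import HarnessLib

/-!
# [GenEll] Proposition 1.6 (Conductor Bounded by the Height) for the `λ`-line — PROVED

S. Mochizuki, *Arithmetic elliptic curves in general position*, Math. J. Okayama Univ. **52** (2010),
Prop. 1.6 (kurims manuscript p. 9) [cite: MochizukiGenEll2010, Prop 1.6 p.9]:

> **Proposition 1.6.** (Conductor Bounded by the Height) Let `D ⊆ X` be an effective Cartier
> divisor, `L̄ = (L, |−|_L)` an arithmetic line bundle on `X` such that `L = O_X(D)`. Write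
> `U := X ∖ D`, `ht_D := ht_L̄` [cf. Proposition 1.4, (iii)]. Then `log-cond_D ≲ ht_D` on `U(Q̄)`.

abc-iut DAG node `GenEll:Prop1.6`. The general statement needs arithmetic line bundles on arithmetic
surfaces (not in the tree); this file PROVES the SPECIAL CASE the downstream chain uses
([IUTchIV] Cor. 2.2/2.3, [GenEll] Thm. 2.1 (ii) are stated for it): `X = ℙ¹_ℚ`, `D = [0]+[1]+[∞]`,
over the tree's presentation of `U(ℚ̄)` by `NFPoint`s (`GenEllProjLine.lean`: `NFPoint.logCond`,
`NFPoint.ht`). Since `deg D = 3`, `ht_D ≈ 3·ht_{𝒪(1)} = 3·ht` (Prop. 1.4 (i), (iii)), and the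
inequality becomes the explicit bound

  `NFPoint.logCond_le : P.InU → P.logCond ≤ 3·P.ht + log 2`,

whence `log-cond_D ≲ 3·ht` on every subset of `U(ℚ̄)` (`bdLe_logCond_three_mul_ht`).
`TODO(general form)`: arbitrary `(X, D, L̄)` as printed.

## Proof (the printed one, unfolded for `ℙ¹`)

"the asserted inequality … follows, for the contributions at the nonarchimedean primes, from the
definition of `log-cond_D` [i.e., involving `(−)_red`]": a prime `v` of `F` lies in the support of the
conductor of `x ∈ F ∖ {0,1}` iff `ord_v x > 0`, `ord_v x < 0` or `ord_v(x−1) > 0`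
(`NFPoint.condSupport`), i.e. iff `|y|_v > 1` for `y = x⁻¹`, `x`, resp. `(x−1)⁻¹`; for such `v`,
`N(v) ≤ |y|_v` (the value group is `N(v)^ℤ`), so the product of the `N(v)` over each of the three
families is at most the non-archimedean part `∏_v max(|y|_v, 1)` of Mathlib's height `H_F(y)`, which is
`≤ H_F(y)`; finally `H_F(x⁻¹) = H_F(x)`, `H_F((x−1)⁻¹) = H_F(x−1) ≤ 2^{[F:ℚ]}·H_F(x)`, so
`N_F(cond) ≤ 2^{[F:ℚ]}·H_F(x)³` and `log-cond ≤ 3·ht + log 2` after dividing by `[F:ℚ]`.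
Classical; no side is taken on anything disputed.
-/

noncomputable section

open NumberField IsDedekindDomain Height Real
open scoped NNReal

namespace Literature.NumberTheory.DiophantineGeometry.GenEll

variable {F : Type*} [Field F] [NumberField F]

/-! ## Local step: at a prime where `|y|_v > 1` one has `N(v) ≤ |y|_v` -/

/-- At a finite place `v` of a number field with `ord_v(y) < 0` (i.e. `1 < v.valuation y` in
Mathlib's multiplicative convention) the normalised absolute value `|y|_v = N(v)^{-ord_v y}` is at
least `N(v)`. (Elementary; the value group of `|·|_v` is `N(v)^ℤ`.) [folklore] -/
private theorem absNorm_le_finitePlace_of_one_lt_valuation (v : HeightOneSpectrum (𝓞 F)) {y : F}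
    (hy : 1 < v.valuation F y) :
    (Ideal.absNorm v.asIdeal : ℝ) ≤ FinitePlace.mk v y := by
  have hy0 : v.valuation F y ≠ 0 := ne_zero_of_lt hy
  rw [FinitePlace.mk_apply, FinitePlace.norm_embedding']
  -- `v.valuation F y = ↑u` with `1 < u`
  set m := v.valuation F y with hm
  obtain ⟨u, hu⟩ : ∃ u : Multiplicative ℤ, (u : WithZero (Multiplicative ℤ)) = m :=
    ⟨WithZero.unzero hy0, WithZero.coe_unzero hy0⟩
  have hu1 : 1 < u := by rw [← WithZero.coe_lt_coe, hu, WithZero.coe_one]; exact hy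
  have hn : 1 ≤ Multiplicative.toAdd u := by
    have : (0 : ℤ) < Multiplicative.toAdd u := by
      rwa [← Multiplicative.ofAdd_lt, ofAdd_toAdd, ofAdd_zero]
    omega
  rw [← hu, WithZeroMulInt.toNNReal_neg_apply _ (WithZero.coe_ne_zero), WithZero.unzero_coe]
  have hN : (1 : ℝ≥0) ≤ (Ideal.absNorm v.asIdeal : ℝ≥0) :=
    (NumberField.HeightOneSpectrum.one_lt_absNorm_nnreal v).le
  have := zpow_le_zpow_right₀ hN hn
  rw [zpow_one] at this
  exact_mod_cast this

/-! ## The non-archimedean part of the height dominates products of `N(v)` over poles -/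

/-- For `y ≠ 0` and a finite set `A` of primes at each of which `ord_v y < 0`:
`∏_{v ∈ A} N(v) ≤ ∏_w max(|y|_w, 1)` (the non-archimedean part of `H_F(y)`). [folklore] -/
private theorem prod_absNorm_le_finprod_max {y : F} (hy : y ≠ 0)
    (A : Finset (HeightOneSpectrum (𝓞 F))) (hA : ∀ v ∈ A, 1 < v.valuation F y) :
    (∏ v ∈ A, (Ideal.absNorm v.asIdeal : ℝ)) ≤ ∏ᶠ w : FinitePlace F, max (w y) 1 := by
  classical
  -- the function `w ↦ max (w y) 1` is `≥ 1` with finite multiplicative support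
  set f : FinitePlace F → ℝ := fun w => max (w y) 1 with hf
  have hf1 : ∀ w, 1 ≤ f w := fun w => le_max_right _ _
  have hfs : f.HasFiniteMulSupport :=
    (FinitePlace.hasFiniteMulSupport hy).max Function.hasFiniteMulSupport_fun_one
  -- compare with the finite product over the image of `A`
  set B : Finset (FinitePlace F) := A.image FinitePlace.mk with hB
  have hprod : ∏ w ∈ B, f w ≤ ∏ᶠ w, f w := by
    rw [finprod_eq_prod_of_mulSupport_subset f (s := hfs.toFinset ∪ B) (by
      intro w hw; exact Finset.mem_union_left _ (hfs.mem_toFinset.mpr hw)),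
      ← Finset.prod_sdiff (Finset.subset_union_right : B ⊆ hfs.toFinset ∪ B)]
    exact le_mul_of_one_le_left (Finset.prod_nonneg fun w _ => zero_le_one.trans (hf1 w))
      (Finset.one_le_prod fun w _ => hf1 w)
  refine le_trans ?_ hprod
  rw [hB, Finset.prod_image fun v _ v' _ h => FinitePlace.mk_eq_iff.mp h]
  refine Finset.prod_le_prod (fun v _ => Nat.cast_nonneg _) fun v hv => ?_
  exact (absNorm_le_finitePlace_of_one_lt_valuation v (hA v hv)).trans (le_max_left _ _)

/-- The non-archimedean part of the height is at most the height: `∏_w max(|y|_w,1) ≤ H_F(y)`.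
[folklore] -/
private theorem finprod_max_le_mulHeight₁ (y : F) :
    (∏ᶠ w : FinitePlace F, max (w y) 1) ≤ mulHeight₁ y := by
  rw [NumberField.mulHeight₁_eq]
  refine le_mul_of_one_le_left (finprod_nonneg fun w => (zero_le_one.trans (le_max_right _ _))) ?_
  exact Finset.one_le_prod fun w _ => one_le_pow₀ (le_max_right _ _)

/-! ## Proposition 1.6 for `(ℙ¹, [0]+[1]+[∞])` -/

/-- In `ℕ`, a product of numbers `≥ 1` over a union is at most the product of the products.
[folklore] -/
private theorem prod_union_le_mul {ι : Type*} [DecidableEq ι] (s t : Finset ι) (f : ι → ℕ)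
    (hf : ∀ i, 1 ≤ f i) : ∏ i ∈ s ∪ t, f i ≤ (∏ i ∈ s, f i) * ∏ i ∈ t, f i := by
  rw [← Finset.prod_union_inter]
  exact Nat.le_mul_of_pos_right _ (Finset.prod_pos fun i _ => hf i)

/-- For `y ≠ 0`: the product of `N(v)` over a finite set of primes with `ord_v y < 0` is at most
`H_F(y)`. [folklore] -/
private theorem prod_absNorm_le_mulHeight₁ {y : F} (hy : y ≠ 0)
    (A : Finset (HeightOneSpectrum (𝓞 F))) (hA : ∀ v ∈ A, 1 < v.valuation F y) :
    (∏ v ∈ A, (Ideal.absNorm v.asIdeal : ℝ)) ≤ mulHeight₁ y :=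
  (prod_absNorm_le_finprod_max hy A hA).trans (finprod_max_le_mulHeight₁ y)

/-- **The radical of the conductor is bounded by `2^{[F:ℚ]}·H_F(x)³`**: for `x ∈ F ∖ {0, 1}`,
`∏_{v ∈ supp cond} N(v) ≤ 2^{[F:ℚ]} · H_F(x)³` — the three parts of the support (zeros of `x`, poles
of `x`, zeros of `x − 1`) are controlled by the non-archimedean parts of `H_F(x⁻¹) = H_F(x)`,
`H_F(x)`, `H_F((x−1)⁻¹) = H_F(x−1) ≤ 2^{[F:ℚ]} H_F(x)`. [cite: MochizukiGenEll2010, Prop 1.6 p.9] -/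
theorem NFPoint.finprod_condSupport_le (P : NFPoint) (hP : P.InU) :
    ((∏ᶠ v ∈ P.condSupport, Ideal.absNorm v.asIdeal : ℕ) : ℝ) ≤
      2 ^ Module.finrank ℚ P.F * mulHeight₁ P.x ^ 3 := by
  classical
  have hx : P.x ≠ 0 := hP.1
  have hx1 : P.x - 1 ≠ 0 := sub_ne_zero.mpr hP.2
  have hfin := P.condSupport_finite hP
  -- the three pieces of the support
  set A₁ : Finset (HeightOneSpectrum (𝓞 P.F)) :=
    hfin.toFinset.filter (fun v => v.valuation P.F P.x < 1) with hA₁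
  set A₂ : Finset (HeightOneSpectrum (𝓞 P.F)) :=
    hfin.toFinset.filter (fun v => 1 < v.valuation P.F P.x) with hA₂
  set A₃ : Finset (HeightOneSpectrum (𝓞 P.F)) :=
    hfin.toFinset.filter (fun v => v.valuation P.F (P.x - 1) < 1) with hA₃
  have hcover : hfin.toFinset ⊆ A₁ ∪ A₂ ∪ A₃ := by
    intro v hv
    have hv' := hfin.mem_toFinset.mp hv
    simp only [NFPoint.condSupport, Set.mem_setOf_eq] at hv'
    simp only [hA₁, hA₂, hA₃, Finset.mem_union, Finset.mem_filter]
    rcases hv' with h | h | h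
    · exact Or.inl (Or.inl ⟨hv, h⟩)
    · exact Or.inl (Or.inr ⟨hv, h⟩)
    · exact Or.inr ⟨hv, h⟩
  have hN1 : ∀ v : HeightOneSpectrum (𝓞 P.F), 1 ≤ Ideal.absNorm v.asIdeal := fun v =>
    Nat.one_le_iff_ne_zero.mpr (by rw [Ne, Ideal.absNorm_eq_zero_iff]; exact v.ne_bot)
  -- step 1 (in `ℕ`): the conductor product is at most the product of the three partial products
  have hstep1 : (∏ᶠ v ∈ P.condSupport, Ideal.absNorm v.asIdeal : ℕ) ≤
      (∏ v ∈ A₁, Ideal.absNorm v.asIdeal) * (∏ v ∈ A₂, Ideal.absNorm v.asIdeal) *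
        ∏ v ∈ A₃, Ideal.absNorm v.asIdeal := by
    rw [finprod_mem_eq_finite_toFinset_prod _ hfin]
    calc ∏ v ∈ hfin.toFinset, Ideal.absNorm v.asIdeal
        ≤ ∏ v ∈ A₁ ∪ A₂ ∪ A₃, Ideal.absNorm v.asIdeal :=
          Finset.prod_le_prod_of_subset_of_one_le' hcover fun v _ _ => hN1 v
      _ ≤ (∏ v ∈ A₁ ∪ A₂, Ideal.absNorm v.asIdeal) * ∏ v ∈ A₃, Ideal.absNorm v.asIdeal :=
          prod_union_le_mul _ _ _ hN1
      _ ≤ _ := Nat.mul_le_mul_right _ (prod_union_le_mul _ _ _ hN1)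
  -- step 2: each partial product is bounded by a height
  have h2 : (∏ v ∈ A₂, (Ideal.absNorm v.asIdeal : ℝ)) ≤ mulHeight₁ P.x :=
    prod_absNorm_le_mulHeight₁ hx A₂ fun v hv => (Finset.mem_filter.mp hv).2
  have h1 : (∏ v ∈ A₁, (Ideal.absNorm v.asIdeal : ℝ)) ≤ mulHeight₁ P.x := by
    rw [← mulHeight₁_inv P.x]
    refine prod_absNorm_le_mulHeight₁ (inv_ne_zero hx) A₁ fun v hv => ?_
    have h := (Finset.mem_filter.mp hv).2
    rw [map_inv₀]
    exact (one_lt_inv₀ (zero_lt_iff.mpr ((Valuation.ne_zero_iff _).mpr hx))).mpr h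
  have h3 : (∏ v ∈ A₃, (Ideal.absNorm v.asIdeal : ℝ)) ≤
      2 ^ Module.finrank ℚ P.F * mulHeight₁ P.x := by
    have h3' : (∏ v ∈ A₃, (Ideal.absNorm v.asIdeal : ℝ)) ≤ mulHeight₁ (P.x - 1) := by
      rw [← mulHeight₁_inv (P.x - 1)]
      refine prod_absNorm_le_mulHeight₁ (inv_ne_zero hx1) A₃ fun v hv => ?_
      have h := (Finset.mem_filter.mp hv).2
      rw [map_inv₀]
      exact (one_lt_inv₀ (zero_lt_iff.mpr ((Valuation.ne_zero_iff _).mpr hx1))).mpr h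
    refine h3'.trans ?_
    have := mulHeight₁_sub_le P.x (1 : P.F)
    rwa [mulHeight₁_one, mul_one, NumberField.totalWeight_eq_finrank] at this
  -- assemble
  have hH : 0 ≤ mulHeight₁ P.x := (mulHeight₁_pos _).le
  calc ((∏ᶠ v ∈ P.condSupport, Ideal.absNorm v.asIdeal : ℕ) : ℝ)
      ≤ ((∏ v ∈ A₁, Ideal.absNorm v.asIdeal) * (∏ v ∈ A₂, Ideal.absNorm v.asIdeal) *
          ∏ v ∈ A₃, Ideal.absNorm v.asIdeal : ℕ) := by exact_mod_cast hstep1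
    _ = (∏ v ∈ A₁, (Ideal.absNorm v.asIdeal : ℝ)) * (∏ v ∈ A₂, (Ideal.absNorm v.asIdeal : ℝ)) *
          ∏ v ∈ A₃, (Ideal.absNorm v.asIdeal : ℝ) := by push_cast; ring
    _ ≤ mulHeight₁ P.x * mulHeight₁ P.x * (2 ^ Module.finrank ℚ P.F * mulHeight₁ P.x) :=
        mul_le_mul (mul_le_mul h1 h2 (Finset.prod_nonneg fun _ _ => Nat.cast_nonneg _) hH) h3
          (Finset.prod_nonneg fun _ _ => Nat.cast_nonneg _) (mul_nonneg hH hH)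
    _ = 2 ^ Module.finrank ℚ P.F * mulHeight₁ P.x ^ 3 := by ring

/-- **[GenEll] Proposition 1.6 for `X = ℙ¹`, `D = [0]+[1]+[∞]`** (p. 9, "log-cond_D ≲ ht_D on
`U(Q̄)`", with `ht_D ≈ 3·ht` since `deg D = 3`), in explicit form: for every point `P ∈ U_X(ℚ̄)`
(presented over any number field), `log-cond_D(P) ≤ 3·ht(P) + log 2`. `TODO(general form)`:
arbitrary `(X, D)` with an arithmetic line bundle `L̄`, `L = 𝒪_X(D)`.
[cite: MochizukiGenEll2010, Prop 1.6 p.9] -/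
theorem NFPoint.logCond_le (P : NFPoint) (hP : P.InU) : P.logCond ≤ 3 * P.ht + Real.log 2 := by
  classical
  have hfin := P.condSupport_finite hP
  have hd : (0 : ℝ) < P.degree := Nat.cast_pos.mpr P.degree_pos
  have hdeg : (Module.finrank ℚ P.F : ℝ) = P.degree := rfl
  have hN1 : ∀ v : HeightOneSpectrum (𝓞 P.F), 1 ≤ Ideal.absNorm v.asIdeal := fun v =>
    Nat.one_le_iff_ne_zero.mpr (by rw [Ne, Ideal.absNorm_eq_zero_iff]; exact v.ne_bot)
  have hpos : (0 : ℝ) < ((∏ᶠ v ∈ P.condSupport, Ideal.absNorm v.asIdeal : ℕ) : ℝ) := by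
    rw [finprod_mem_eq_finite_toFinset_prod _ hfin]
    exact_mod_cast Finset.prod_pos fun v _ => hN1 v
  have hH : 0 < mulHeight₁ P.x := mulHeight₁_pos _
  have hle := P.finprod_condSupport_le hP
  have hlog : Real.log ((∏ᶠ v ∈ P.condSupport, Ideal.absNorm v.asIdeal : ℕ) : ℝ) ≤
      Module.finrank ℚ P.F * Real.log 2 + 3 * logHeight₁ P.x := by
    calc _ ≤ Real.log (2 ^ Module.finrank ℚ P.F * mulHeight₁ P.x ^ 3) := Real.log_le_log hpos hle
      _ = _ := by
          rw [Real.log_mul (by positivity) (by positivity), Real.log_pow, Real.log_pow,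
            logHeight₁_eq_log_mulHeight₁]; push_cast; ring
  unfold NFPoint.logCond NFPoint.ht
  rw [hdeg] at hlog
  have hinv : (P.degree : ℝ)⁻¹ * (P.degree * Real.log 2 + 3 * logHeight₁ P.x) =
      3 * ((P.degree : ℝ)⁻¹ * logHeight₁ P.x) + Real.log 2 := by
    field_simp
    ring
  calc (P.degree : ℝ)⁻¹ * Real.log ((∏ᶠ v ∈ P.condSupport, Ideal.absNorm v.asIdeal : ℕ) : ℝ)
      ≤ (P.degree : ℝ)⁻¹ * (P.degree * Real.log 2 + 3 * logHeight₁ P.x) :=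
        mul_le_mul_of_nonneg_left hlog (inv_nonneg.mpr hd.le)
    _ = 3 * ((P.degree : ℝ)⁻¹ * logHeight₁ P.x) + Real.log 2 := hinv

/-- **[GenEll] Prop. 1.6 for the `λ`-line in BD-class form**: on every set `S` of points of
`U_X(ℚ̄)`, `log-cond_{[0]+[1]+[∞]} ≲_S 3·ht` (`BDLe`, [GenEll] Def. 1.2 (ii)).
[cite: MochizukiGenEll2010, Prop 1.6 p.9] -/
theorem bdLe_logCond_three_mul_ht {S : Set NFPoint} (hS : ∀ P ∈ S, P.InU) :
    BDLe S NFPoint.logCond (fun P => 3 * P.ht) :=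
  ⟨Real.log 2, fun P hP => by linarith [NFPoint.logCond_le P (hS P hP)]⟩

/-- In particular on `U_X(ℚ̄)^{≤ d}` (the sets of [GenEll] Thm. 2.1). [cite: MochizukiGenEll2010, Prop 1.6 p.9] -/
theorem bdLe_logCond_three_mul_ht_UPle (d : ℕ) :
    BDLe (UPle d) NFPoint.logCond (fun P => 3 * P.ht) :=
  bdLe_logCond_three_mul_ht fun _ hP => hP.1.1

end Literature.NumberTheory.DiophantineGeometry.GenEll

end
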